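import Summits.BirchSwinnertonDyer.BirchSwinnertonDyer.Theorems.InertBadSignedBranchesInertBadOffCornerTprime
import Summits.BirchSwinnertonDyer.BirchSwinnertonDyer.Theorems.InertBadSignedBranchesInertBadAtThreeGlue
import Summits.BirchSwinnertonDyer.BirchSwinnertonDyer.Theses.KatoDescentTamePotSupersingular
import HarnessLib

/-!
# Route `InertBadSignedBranches` (rung K8-inert, cell bsd-cm): the HELD residuals `InertBadAtThreeOffIstarZero`
# (stmt-BirchSwinnertonDyer-19657) and `InertBadOffType` (stmt-BirchSwinnertonDyer-19224) are, BY NAME, the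
# CM-inert rows of bsd-potss's residual `KatoDescentTamePotSupersingular.TameRankOne` (stmt-BirchSwinnertonDyer-19984);
# the LOSSLESS SPLIT of that residual by CM type, with the CM-split cell proved EMPTY
# (a `--supports 19657` helper; seat bsd-cm-k8i-c42 g12; theorems only; cross-route record)

PARTITION (D-0054): CornerF-inert (B12/O10) × O10 off `I₀*` (O10-SC@3 ⊔ O10-SC at `p ≥ 5`) × `p` inert —
types-the-object-of (a by-name DOMINATION between two cells' declared residuals and the CM-type split of the
dominating one; closes no cell and no item; moves no label; BSD is not advanced by any of this).

The companion file `InertBadSignedBranchesInertBadOffCornerTprime.lean` (K8 cone only, p483849) proves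
`(InertBadOffType ∧ InertBadAtThreeOffIstarZero) ⟺ «CM-inert rows of the census cell (t′), analytic rank one»`.
This sequel also imports the bsd-potss route file `Theses/KatoDescentTamePotSupersingular.lean` and reads its
declared residual `TameRankOne` (`∀ W p, r_an = 1 → p ≠ 2 → Addv W p → SubTprime W p → MissingPPartAt W p`,
item 19984, `[difficulty: open-problem]`) BY NAME:
* §1 DOMINATION: `inertBadAtThreeOffIstarZero_of_tameRankOne` (item 19657 ⟸ 19984),
  `inertBadOffType_of_tameRankOne` (item 19224 ⟸ 19984), and `InertBadAtThree` (item 19225) ⟸ its `I₀*`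
  child 19656 ∧ 19984 through the landed D71 glue.
* §2 THE CM-SPLIT CELL OF (t′) IS EMPTY: a CM curve additive at a prime `p ≠ 2` SPLIT in its CM field is
  never (t′) — at `p ≥ 5` its semistability defect divides `p − 1` (`j = 0`: `p ≡ 1 (3)`, `e ∈ {2, 3, 6}`;
  `j = 1728`: `p ≡ 1 (4)`, `e ∈ {2, 4}`; otherwise `I₀*`, `e = 2` — Delbourgo's cell (G), the potentially
  ORDINARY primes), and at `p = 3` it is of type `I₀*` (x1b's classifications
  `X12.hasGoodReductionAt_or_kodairaSymbolAt_of_hasCM(_three)` + the b2b valuation table).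
* §3 LOSSLESS SPLIT BY CM TYPE: `tameRankOne_iff_cmTypeSplit` —
  `TameRankOne ⟺ (non-CM (t′) rows) ∧ (CM rows at a prime RAMIFIED in the CM field) ∧ InertBadOffType ∧
  InertBadAtThreeOffIstarZero`, the first two conjuncts written inline (no new definition). The CM-ramified
  (t′) rank-one rows are the O11-type corners (e.g. the twists of `49a` at `7`, Kodaira `III`, `e = 4 ∤ 6` —
  rung K7r's class `𝒞₇` — and `j = 0` at `3`); the non-CM rows are 19984's own core.
So in the ledger's residual bookkeeping the K8-inert rows 19657 / 19224 are SUB-ROWS of the K8-t′ row 19984 (no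
independent residual mass), a closure of 19984 closes both K8 children by the §1 terms, and conversely the two
K8 children discharge exactly the CM-inert part of 19984.

HONEST LABEL. Both sides are declared residuals (open problems in print); §1/§3 are implications and an
equivalence between open statements, unconditional as such; §2 is unconditional arithmetic of Kodaira types;
nothing is booked; no item is closed.
References: [SilvermanATAEC1994] IV.9.4, Table 4.1 (PDF p. 365) and App. A §3; [Cox2013] Prop. 5.16 / Cor. 5.17;
[Miller2011LMS] Def. 1.1; [Kato2004Asterisque] Conj. 12.10 (p. 224).
-/

set_option autoImplicit false
set_option linter.dupNamespace false

noncomputable section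

open scoped Classical NumberField

open WeierstrassCurve NumberField IsDedekindDomain IsDedekindDomain.HeightOneSpectrum Rat.HeightOneSpectrum
open Literature.NumberTheory.EllipticCurves
open Literature.NumberTheory.EllipticCurves.Rank1Residual
open Literature.NumberTheory.EllipticCurves.Rank1Residual.Typed
open Literature.NumberTheory.DiophantineGeometry (KodairaSymbol)
open Summit.BirchSwinnertonDyer.Rank1Residual
open Summit.BirchSwinnertonDyer.Rank1Residual.Additive
open Summit.BirchSwinnertonDyer.Rank1Residual.X12.O10
open Summit.BirchSwinnertonDyer.BirchSwinnertonDyer.Theses.InertBadSignedBranches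
open Summit.BirchSwinnertonDyer.BirchSwinnertonDyer.Theses.KatoDescentTamePotSupersingular (TameRankOne)
open Summit.BirchSwinnertonDyer.BirchSwinnertonDyer.Theorems.InertBadLeafKMCPerrinRiou

namespace Summit.BirchSwinnertonDyer.BirchSwinnertonDyer.Theorems.InertBadOffTprime

/-! ## §1 Domination by name -/

/-- **bsd-potss's tame rank-one residual ⟹ its CM-inert rows in K8 currency** (restriction of
`TameRankOne` to CM curves at a prime inert in the CM field; the Li–Liu–Tian clause of `X12.MissingInputAt`
is void there). [cite: Miller2011LMS, Def. 1.1] -/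
theorem tprimeCMInertRows_of_tameRankOne (h : TameRankOne) (W : WeierstrassCurve ℚ) [W.IsElliptic]
    [W.IsGloballyMinimal] (p : ℕ) [Fact p.Prime] (_hCM : W.HasCM) (_hin : CMInert W p)
    (hr : W.analyticRank = 1) (hp2 : p ≠ 2) (hadd : Addv W p) (hT : SubTprime W p) :
    X12.MissingInputAt W p :=
  fun _ ↦ h W p hr hp2 hadd hT

/-- **DOMINATION, `p = 3`: `TameRankOne` (item 19984) ⟹ `InertBadAtThreeOffIstarZero` (item 19657).**
The off-`I₀*` inert-bad corner at `3` is (t′) (`subTprime_three_of_offIstarZero`).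
[cite: SilvermanATAEC1994, IV.9.4 and Table 4.1] [cite: Miller2011LMS, Def. 1.1] -/
theorem inertBadAtThreeOffIstarZero_of_tameRankOne (h : TameRankOne) : InertBadAtThreeOffIstarZero :=
  (inertBadOff_of_tprimeCMInertRows (tprimeCMInertRows_of_tameRankOne h)).2

/-- **DOMINATION, `p ≥ 5`: `TameRankOne` (item 19984) ⟹ `InertBadOffType` (item 19224).**
The off-`I₀*` inert-bad corner at `p ≥ 5` is (t′) (`subTprime_of_offIstarZero_of_five_le`).
[cite: SilvermanATAEC1994, IV.9.4 and Table 4.1] [cite: Miller2011LMS, Def. 1.1] -/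
theorem inertBadOffType_of_tameRankOne (h : TameRankOne) : InertBadOffType :=
  (inertBadOff_of_tprimeCMInertRows (tprimeCMInertRows_of_tameRankOne h)).1

/-- **`InertBadAtThree` (item 19225) ⟸ its `I₀*` child (item 19656) ∧ `TameRankOne` (item 19984)**, through
the landed D71 glue. [cite: SilvermanATAEC1994, IV.9.4 and Table 4.1] [cite: Miller2011LMS, Def. 1.1] -/
theorem inertBadAtThree_of_istarZero_of_tameRankOne (h0 : InertBadAtThreeIstarZero) (h : TameRankOne) :
    InertBadAtThree :=
  inertBadSignedBranches_inertBadAtThreeGlue_proof h0 (inertBadAtThreeOffIstarZero_of_tameRankOne h)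

/-! ## §2 The CM-split cell of (t′) is empty -/

section SplitEmpty

variable (W : WeierstrassCurve ℚ) [W.IsElliptic] [W.IsGloballyMinimal]

/-- An odd prime `p ≥ 5` other than `3` is `≢ 0 (mod 3)`; with `p ≢ 2 (mod 3)` this gives `p ≡ 1 (mod 3)`.
[folklore] -/
theorem mod_three_eq_one_of_prime_of_five_le {p : ℕ} (hp : p.Prime) (hp5 : 5 ≤ p) (h2 : ¬ p % 3 = 2) :
    p % 3 = 1 := by
  have h3 : ¬ 3 ∣ p := fun h ↦ by
    rcases hp.eq_one_or_self_of_dvd 3 h with h | h <;> omega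
  omega

/-- **At a prime `p ≥ 5` SPLIT in the CM field, an additive CM curve is in Delbourgo's cell (G)**: its
semistability defect divides `p − 1` (`j = 0`: `p ≡ 1 (3)`, symbols `II, IV, I₀*, IV*, II*`, `e ∈ {6, 3, 2,
3, 6}`; `j = 1728`: `p ≡ 1 (4)`, symbols `III, I₀*, III*`, `e ∈ {4, 2, 4}`; otherwise `I₀*`, `e = 2`).
[cite: SilvermanATAEC1994, IV.9.4, Table 4.1 (PDF p. 365) and App. A §3] [cite: Cox2013, Prop. 5.16 and Cor. 5.17] -/
theorem semistabilityIndex_dvd_of_hasCM_of_cmSplit_of_five_le (p : ℕ) [hp : Fact p.Prime] (hp5 : 5 ≤ p)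
    (hCM : W.HasCM) (hsplit : CMSplit W p) (hadd : Addv W p) : semistabilityIndex W p ∣ p - 1 := by
  obtain ⟨v, hv⟩ := exists_place p
  have hbad' : ¬ W.HasGoodReductionAt v := by
    rw [← X12.good_iff_hasGoodReductionAt W p v hv]; exact hadd.1
  have htr : W.kodairaSymbolAt v = W.kodairaSymbolAt (placeOf p) := kodairaSymbolAt_eq_placeOf p W v hv
  have hp2 : p ≠ 2 := by omega
  have hp3 : p ≠ 3 := by omega
  have hodd : p % 2 = 1 := Nat.odd_iff.mp (hp.out.odd_of_ne_two hp2)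
  have hnr : ¬ CMRamified W p := hsplit.1
  have hnin : ¬ CMInert W p := fun h ↦ h.2 hsplit
  have hclass := X12.hasGoodReductionAt_or_kodairaSymbolAt_of_hasCM W hCM v (hv.symm ▸ hp5) (hv.symm ▸ hnr)
  rw [htr] at hclass
  unfold semistabilityIndex
  rcases hclass with hgood | ⟨hj, hk⟩ | ⟨hj, hk⟩ | ⟨-, -, hk⟩
  · exact absurd hgood hbad'
  · -- `j = 0`: `p ≡ 1 (mod 3)`
    have hmod : p % 3 = 1 := mod_three_eq_one_of_prime_of_five_le hp.out hp5
      (fun h ↦ hnin ((X12.cmInert_iff_mod_three_eq_two_of_j_eq_zero W p hp2 hp3 hj).mpr h))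
    rcases hk with hk | hk | hk | hk | hk <;>
      rw [padicValInt_minimalDiscriminantInt_of_kodairaSymbolAt W p hp5 hadd hk] <;>
      simp only [KodairaSymbol.numComponents, Nat.reduceAdd, Nat.reduceGcd, Nat.reduceDiv] <;> omega
  · -- `j = 1728`: `p ≡ 1 (mod 4)`
    have hmod : p % 4 = 1 := by
      have h3 : ¬ p % 4 = 3 :=
        fun h ↦ hnin ((X12.cmInert_iff_mod_four_eq_three_of_j_eq_1728 W p hp2 hj).mpr h)
      omega
    rcases hk with hk | hk | hk <;>
      rw [padicValInt_minimalDiscriminantInt_of_kodairaSymbolAt W p hp5 hadd hk] <;>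
      simp only [KodairaSymbol.numComponents, Nat.reduceAdd, Nat.reduceGcd, Nat.reduceDiv] <;> omega
  · rw [padicValInt_minimalDiscriminantInt_of_kodairaSymbolAt W p hp5 hadd hk]
    simp only [KodairaSymbol.numComponents, Nat.reduceAdd, Nat.reduceGcd, Nat.reduceDiv]
    omega

omit [W.IsGloballyMinimal] in
/-- **At `3` SPLIT in the CM field, an additive CM curve has Kodaira type `I₀*`** (x1b's classification at
`3` off `ℚ(√−3)`: `j = 1728` is excluded because `3` is inert in `ℚ(i)`; every other unramified CM `j` is of
type `I₀*`). [cite: SilvermanATAEC1994, IV.9.4, Table 4.1 and App. A §3] [cite: Cox2013, Prop. 5.16 and Cor. 5.17] -/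
theorem kodairaSymbolAt_placeOf_three_of_hasCM_of_cmSplit [Fact (Nat.Prime 3)] (hCM : W.HasCM)
    (hsplit : CMSplit W 3) (hadd : Addv W 3) : W.kodairaSymbolAt (placeOf 3) = .Istar 0 := by
  obtain ⟨v, hv⟩ := exists_place 3
  have hbad' : ¬ W.HasGoodReductionAt v := by
    rw [← X12.good_iff_hasGoodReductionAt W 3 v hv]; exact hadd.1
  have htr : W.kodairaSymbolAt v = W.kodairaSymbolAt (placeOf 3) := kodairaSymbolAt_eq_placeOf 3 W v hv
  have hnin : ¬ CMInert W 3 := fun h ↦ h.2 hsplit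
  rcases X12.hasGoodReductionAt_or_kodairaSymbolAt_of_hasCM_three W hCM v hv hsplit.1 with
      hgood | ⟨hj, -⟩ | ⟨-, -, hk⟩
  · exact absurd hgood hbad'
  · exact absurd ((X12.cmInert_iff_mod_four_eq_three_of_j_eq_1728 W 3 (by decide) hj).mpr rfl) hnin
  · exact htr ▸ hk

/-- **THE CM-SPLIT CELL OF (t′) IS EMPTY**: a CM curve additive at a prime `p ≠ 2` split in its CM field is
not (t′) (`p ≥ 5`: cell (G); `p = 3`: type `I₀*`, while (t′)@3 = `III`/`III*`).
[cite: SilvermanATAEC1994, IV.9.4 and Table 4.1 (PDF p. 365)] [cite: Cox2013, Prop. 5.16 and Cor. 5.17] -/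
theorem not_subTprime_of_hasCM_of_cmSplit (p : ℕ) [hp : Fact p.Prime] (hp2 : p ≠ 2) (hCM : W.HasCM)
    (hsplit : CMSplit W p) (hadd : Addv W p) : ¬ SubTprime W p := by
  rcases eq_three_or_five_le_of_prime_of_ne_two hp.out hp2 with h | hp5
  · subst h
    intro hT
    have hk := kodairaSymbolAt_placeOf_three_of_hasCM_of_cmSplit W hCM hsplit hadd
    rcases (subTprime_three_iff_kodairaSymbolAt_III_or_IIIstar W hadd).mp hT with h | h <;>
      rw [hk] at h <;> exact absurd h (by decide)
  · exact fun hT ↦ hT.2.2 (semistabilityIndex_dvd_of_hasCM_of_cmSplit_of_five_le W p hp5 hCM hsplit hadd)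

end SplitEmpty

/-! ## §3 The lossless split of `TameRankOne` by CM type -/

/-- **LOSSLESS SPLIT OF bsd-potss's RESIDUAL `TameRankOne` (item 19984) BY CM TYPE.** The tame rank-one body
is equivalent to the conjunction of: its NON-CM rows (its own honest core, inline); its CM rows at a prime
RAMIFIED in the CM field (the O11-type corners, inline); and the two K8-inert HELD residuals off `I₀*`
(`InertBadOffType`, item 19224; `InertBadAtThreeOffIstarZero`, item 19657) — the CM-SPLIT rows being EMPTY
(§2) and the CM-inert rows being exactly the K8 corner (companion file). Unconditional; closes nothing.
[cite: SilvermanATAEC1994, IV.9.4 and Table 4.1] [cite: Cox2013, Prop. 5.16 and Cor. 5.17] [cite: Miller2011LMS, Def. 1.1] -/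
theorem tameRankOne_iff_cmTypeSplit :
    TameRankOne ↔
      (∀ (W : WeierstrassCurve ℚ) [W.IsElliptic] [W.IsGloballyMinimal] (p : ℕ) [Fact p.Prime],
          ¬ W.HasCM → W.analyticRank = 1 → p ≠ 2 → Addv W p → SubTprime W p → MissingPPartAt W p) ∧
      (∀ (W : WeierstrassCurve ℚ) [W.IsElliptic] [W.IsGloballyMinimal] (p : ℕ) [Fact p.Prime],
          W.HasCM → CMRamified W p → W.analyticRank = 1 → p ≠ 2 → Addv W p → SubTprime W p →
            MissingPPartAt W p) ∧
      InertBadOffType ∧ InertBadAtThreeOffIstarZero := by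
  constructor
  · intro h
    refine ⟨fun W _ _ p _ _ hr hp2 hadd hT ↦ h W p hr hp2 hadd hT,
      fun W _ _ p _ _ _ hr hp2 hadd hT ↦ h W p hr hp2 hadd hT, ?_⟩
    exact inertBadOff_of_tprimeCMInertRows (tprimeCMInertRows_of_tameRankOne h)
  · rintro ⟨hnonCM, hram, h5, h3⟩ W _ _ p _ hr hp2 hadd hT
    by_cases hCM : W.HasCM
    · by_cases hr' : CMRamified W p
      · exact hram W p hCM hr' hr hp2 hadd hT
      · by_cases hs : CMSplit W p
        · exact absurd hT (not_subTprime_of_hasCM_of_cmSplit W p hp2 hCM hs hadd)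
        · exact inertBadOff_iff_tprimeCMInertRows'.mp ⟨h5, h3⟩ W p hCM ⟨hr', hs⟩ hr hp2 hadd hT
    · exact hnonCM W p hCM hr hp2 hadd hT

/-- **Read-back for bsd-potss**: granted the two K8-inert residuals off `I₀*`, `TameRankOne` reduces to its
non-CM rows and its CM-ramified rows. [cite: Miller2011LMS, Def. 1.1] -/
theorem tameRankOne_of_nonCM_of_cmRamified_of_inertBadOff
    (hnonCM : ∀ (W : WeierstrassCurve ℚ) [W.IsElliptic] [W.IsGloballyMinimal] (p : ℕ) [Fact p.Prime],
      ¬ W.HasCM → W.analyticRank = 1 → p ≠ 2 → Addv W p → SubTprime W p → MissingPPartAt W p)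
    (hram : ∀ (W : WeierstrassCurve ℚ) [W.IsElliptic] [W.IsGloballyMinimal] (p : ℕ) [Fact p.Prime],
      W.HasCM → CMRamified W p → W.analyticRank = 1 → p ≠ 2 → Addv W p → SubTprime W p →
        MissingPPartAt W p)
    (h5 : InertBadOffType) (h3 : InertBadAtThreeOffIstarZero) : TameRankOne :=
  tameRankOne_iff_cmTypeSplit.mpr ⟨hnonCM, hram, h5, h3⟩

end Summit.BirchSwinnertonDyer.BirchSwinnertonDyer.Theorems.InertBadOffTprime

end
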